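import Mathlib.MeasureTheory.Integral.Layercake
import Mathlib.MeasureTheory.Measure.Typeclasses.Probability
import Mathlib.Analysis.SpecialFunctions.ImproperIntegrals
import Mathlib.Analysis.SpecialFunctions.Log.Basic
import HarnessLib

/-!
# Localized second-moment bound from a sub-Gaussian tail constraint

Probability/Distributions support file (everything proved; no definitions, no named facts).

Main result `setIntegral_pos_sq_le_of_setIntegral_le_tail` (the abstract probabilistic core of
the localized form of R. Bamler 2020a, Prop. 4.2). Let `q` be a bounded measurable function on a
probability space `(X, ν)` satisfying the *tail constraint*

  `∫_Y q dν ≤ F (ν Y)` for every measurable `Y ⊆ X`,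

with a profile `F b ≤ C₁ b √(1 - log b)` for `b ∈ (0, 1]` (`C₁ > 0`). Then for every measurable `Y`

  `∫_Y (q⁺)² dν ≤ 2 C₁² a (1 - log a)`, `a = ν Y`.

Proof.
* Sub-Gaussian superlevel tails (`measureReal_le_exp_of_setIntegral_le_tail`): if `S ⊆ {q > l}`
  is measurable with `b = ν S > 0` and `l > 0`, then `l b ≤ ∫_S q ≤ F b ≤ C₁ b √(1 - log b)`, so
  `l ≤ C₁ √(1 - log b)`, i.e. `b ≤ exp (1 - l² / C₁²)`.
* Layer cake (`MeasureTheory.lintegral_eq_lintegral_meas_lt`) for `f = (q⁺)²` on `ν|_Y`: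
  `∫_Y f dν = ∫₀^∞ ν(Y ∩ {f > t}) dt`, and for `t > 0`, `Y ∩ {f > t} ⊆ {q > √t}`, so the
  integrand is at most `min (a, exp (1 - t / C₁²))`. Splitting at `T = C₁² (1 - log a)`,
  `∫₀^T a dt = C₁² a (1 - log a)` and `∫_T^∞ exp (1 - t / C₁²) dt = C₁² exp (1 - T / C₁²) = C₁² a`;
  the total `C₁² a (2 - log a)` is at most `2 C₁² a (1 - log a)` because `log a ≤ 0`.

What is NOT here: the heat-kernel input producing the tail constraint (Bamler's Theorem 4.1 and
(4.7)), the profile bound `Φ' ∘ Φ⁻¹ (b) ≤ C₁ b √(1 - log b)`, and the negative part of `q`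
(apply the result to `-q`, whose tail constraint has the profile `b ↦ F (1 - b)`).

## References

* R. H. Bamler, *Entropy and heat kernel bounds on a Ricci flow background*, arXiv:2008.07093
  (2020), §4, Theorem 4.1 and Proposition 4.2. [Bamler2020Entropy]
-/

noncomputable section

namespace Literature.Probability.Distributions

open Set _root_.MeasureTheory

/-- **Sub-Gaussian superlevel tails from a tail constraint.** On a probability space `(X, ν)`
let `q` be bounded and measurable with `∫_Y q dν ≤ F (ν Y)` for every measurable `Y`, where
`F b ≤ C₁ b √(1 - log b)` on `(0, 1]` and `C₁ > 0`. If `S ⊆ {q > l}` is measurable and `l > 0`,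
then `ν S ≤ exp (1 - l² / C₁²)`.

Indeed, with `b = ν S > 0`: `l b ≤ ∫_S q ≤ F b ≤ C₁ b √(1 - log b)`, so `l² ≤ C₁² (1 - log b)`.
This is the passage from (4.7) to Gaussian tail bounds in Bamler (2020a), §4. [folklore] -/
theorem measureReal_le_exp_of_setIntegral_le_tail {X : Type*} [MeasurableSpace X]
    (ν : Measure X) [IsProbabilityMeasure ν] {q : X → ℝ} (hqm : Measurable q)
    (hqbdd : ∃ B : ℝ, ∀ x, |q x| ≤ B) {F : ℝ → ℝ} {C₁ : ℝ} (hC₁ : 0 < C₁)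
    (hF : ∀ b ∈ Ioc (0 : ℝ) 1, F b ≤ C₁ * b * Real.sqrt (1 - Real.log b))
    (htail : ∀ Y : Set X, MeasurableSet Y → ∫ x in Y, q x ∂ν ≤ F (ν.real Y))
    {l : ℝ} (hl : 0 < l) {S : Set X} (hS : MeasurableSet S) (hSq : S ⊆ {x | l < q x}) :
    ν.real S ≤ Real.exp (1 - l ^ 2 / C₁ ^ 2) := by
  obtain ⟨B, hB⟩ := hqbdd
  have hb0 : 0 ≤ ν.real S := measureReal_nonneg
  have hb1 : ν.real S ≤ 1 := measureReal_le_one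
  rcases hb0.eq_or_lt with hbz | hbpos
  · rw [← hbz]; exact (Real.exp_pos _).le
  -- the bounded measurable `q` is integrable
  have hqi : Integrable q ν :=
    Integrable.of_bound hqm.aestronglyMeasurable B
      (ae_of_all _ fun x => by rw [Real.norm_eq_abs]; exact hB x)
  -- `l ν S ≤ ∫_S q ≤ F (ν S) ≤ C₁ ν S √(1 - log ν S)`
  have h1 : l * ν.real S ≤ ∫ x in S, q x ∂ν := by
    have hc : ∫ _ in S, l ∂ν = l * ν.real S := by
      rw [setIntegral_const, smul_eq_mul, mul_comm]
    rw [← hc]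
    exact setIntegral_mono_on (integrable_const l).integrableOn hqi.integrableOn hS
      fun x hx => (hSq hx).le
  have h2 : l * ν.real S ≤ C₁ * Real.sqrt (1 - Real.log (ν.real S)) * ν.real S :=
    calc l * ν.real S ≤ ∫ x in S, q x ∂ν := h1
      _ ≤ F (ν.real S) := htail S hS
      _ ≤ C₁ * ν.real S * Real.sqrt (1 - Real.log (ν.real S)) := hF _ ⟨hbpos, hb1⟩
      _ = C₁ * Real.sqrt (1 - Real.log (ν.real S)) * ν.real S := by ring
  have h3 : l ≤ C₁ * Real.sqrt (1 - Real.log (ν.real S)) := le_of_mul_le_mul_right h2 hbpos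
  have hlog : Real.log (ν.real S) ≤ 0 := Real.log_nonpos hb0 hb1
  have h4 : l ^ 2 ≤ C₁ ^ 2 * (1 - Real.log (ν.real S)) := by
    have := pow_le_pow_left₀ hl.le h3 2
    rwa [mul_pow, Real.sq_sqrt (by linarith)] at this
  have h5 : l ^ 2 / C₁ ^ 2 ≤ 1 - Real.log (ν.real S) := by
    rw [div_le_iff₀ (pow_pos hC₁ 2)]; linarith
  calc ν.real S = Real.exp (Real.log (ν.real S)) := (Real.exp_log hbpos).symm
    _ ≤ Real.exp (1 - l ^ 2 / C₁ ^ 2) := Real.exp_le_exp.mpr (by linarith)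

/-- **Localized second-moment bound from a sub-Gaussian tail constraint** (abstract core of the
localized Prop. 4.2 of Bamler 2020a). On a probability space `(X, ν)` let `q` be bounded and
measurable with `∫_Y q dν ≤ F (ν Y)` for every measurable `Y`, where `F b ≤ C₁ b √(1 - log b)` for
`b ∈ (0, 1]` and `C₁ > 0`. Then for every measurable `Y`, with `a = ν Y`,

  `∫_Y (max q 0)² dν ≤ 2 C₁² a (1 - log a)`.

Proof: the superlevel sets `Y ∩ {(q⁺)² > t}` (`t > 0`) have measure at most
`min (a, exp (1 - t / C₁²))` (`measureReal_le_exp_of_setIntegral_le_tail` at level `√t`); integrate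
this in `t` by the layer cake formula, splitting at `T = C₁² (1 - log a)`.
[cite: Bamler2020Entropy, §4, proof of Prop. 4.2] -/
theorem setIntegral_pos_sq_le_of_setIntegral_le_tail {X : Type*} [MeasurableSpace X]
    (ν : Measure X) [IsProbabilityMeasure ν] {q : X → ℝ} (hqm : Measurable q)
    (hqbdd : ∃ B : ℝ, ∀ x, |q x| ≤ B) {F : ℝ → ℝ} {C₁ : ℝ} (hC₁ : 0 < C₁)
    (hF : ∀ b ∈ Ioc (0 : ℝ) 1, F b ≤ C₁ * b * Real.sqrt (1 - Real.log b))
    (htail : ∀ Y : Set X, MeasurableSet Y → ∫ x in Y, q x ∂ν ≤ F (ν.real Y))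
    {Y : Set X} (hY : MeasurableSet Y) :
    ∫ x in Y, (max (q x) 0) ^ 2 ∂ν ≤ 2 * C₁ ^ 2 * ν.real Y * (1 - Real.log (ν.real Y)) := by
  -- `f = (q⁺)²`, `a = ν Y`
  set f : X → ℝ := fun x => (max (q x) 0) ^ 2 with hf
  have hfm : Measurable f := (hqm.max measurable_const).pow_const 2
  have hf0 : ∀ x, 0 ≤ f x := fun x => sq_nonneg _
  set a : ℝ := ν.real Y with ha
  have ha0 : 0 ≤ a := measureReal_nonneg
  have ha1 : a ≤ 1 := measureReal_le_one
  rcases ha0.eq_or_lt with haz | hapos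
  · -- `ν Y = 0`: both sides vanish
    have hY0 : ν Y = 0 := (measureReal_eq_zero_iff (measure_ne_top ν Y)).mp haz.symm
    have hres : ν.restrict Y = 0 := Measure.restrict_eq_zero.mpr hY0
    rw [hres, integral_zero_measure, ← haz]
    simp
  have hlog : Real.log a ≤ 0 := Real.log_nonpos ha0 ha1
  have hlev : ∀ t : ℝ, MeasurableSet {x | t < f x} := fun t =>
    measurableSet_lt measurable_const hfm
  -- bound (a) on the superlevel sets inside `Y`: by `ν Y`
  have hbd1 : ∀ t : ℝ, ν.restrict Y {x | t < f x} ≤ ENNReal.ofReal a := fun t =>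
    calc ν.restrict Y {x | t < f x} ≤ ν.restrict Y univ := measure_mono (subset_univ _)
      _ = ν Y := Measure.restrict_apply_univ Y
      _ = ENNReal.ofReal a := (ofReal_measureReal (measure_ne_top ν Y)).symm
  -- bound (b) on the superlevel sets inside `Y`: sub-Gaussian
  set c : ℝ := -(C₁ ^ 2)⁻¹ with hc
  have hc0 : c < 0 := neg_neg_of_pos (inv_pos.mpr (pow_pos hC₁ 2))
  have hbd2 : ∀ t : ℝ, 0 < t →
      ν.restrict Y {x | t < f x} ≤ ENNReal.ofReal (Real.exp 1 * Real.exp (c * t)) := by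
    intro t ht
    have hsub : {x | t < f x} ∩ Y ⊆ {x | Real.sqrt t < q x} := by
      rintro x ⟨hx, -⟩
      have hx' : Real.sqrt t < max (q x) 0 := by
        have h := Real.sqrt_lt_sqrt ht.le hx
        rwa [Real.sqrt_sq (le_max_right _ _)] at h
      rcases lt_max_iff.mp hx' with h | h
      · exact h
      · exact absurd h (Real.sqrt_nonneg t).not_gt
    have key := measureReal_le_exp_of_setIntegral_le_tail ν hqm hqbdd hC₁ hF htail
      (Real.sqrt_pos.mpr ht) ((hlev t).inter hY) hsub
    rw [Real.sq_sqrt ht.le] at key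
    calc ν.restrict Y {x | t < f x} = ν ({x | t < f x} ∩ Y) := Measure.restrict_apply (hlev t)
      _ = ENNReal.ofReal (ν.real ({x | t < f x} ∩ Y)) :=
          (ofReal_measureReal (measure_ne_top ν _)).symm
      _ ≤ ENNReal.ofReal (Real.exp (1 - t / C₁ ^ 2)) := ENNReal.ofReal_le_ofReal key
      _ = ENNReal.ofReal (Real.exp 1 * Real.exp (c * t)) := by
          rw [← Real.exp_add, hc]; congr 1; ring
  -- layer cake on `ν|_Y`, split at `T = C₁² (1 - log a)`
  have hlc : ∫⁻ x, ENNReal.ofReal (f x) ∂(ν.restrict Y) =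
      ∫⁻ t in Ioi 0, ν.restrict Y {x | t < f x} :=
    lintegral_eq_lintegral_meas_lt _ (ae_of_all _ hf0) hfm.aemeasurable
  set T : ℝ := C₁ ^ 2 * (1 - Real.log a) with hT
  have hT0 : 0 ≤ T := mul_nonneg (sq_nonneg _) (by linarith)
  have hp1 : ∫⁻ t in Ioc 0 T, ν.restrict Y {x | t < f x} ≤ ENNReal.ofReal (a * T) :=
    calc ∫⁻ t in Ioc 0 T, ν.restrict Y {x | t < f x}
        ≤ ∫⁻ _ in Ioc 0 T, ENNReal.ofReal a := lintegral_mono fun t => hbd1 t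
      _ = ENNReal.ofReal (a * T) := by
          rw [setLIntegral_const, Real.volume_Ioc, sub_zero, ← ENNReal.ofReal_mul ha0]
  have hint : IntegrableOn (fun t => Real.exp 1 * Real.exp (c * t)) (Ioi T) :=
    Integrable.const_mul (integrableOn_exp_mul_Ioi hc0 T) (Real.exp 1)
  have hp2 : ∫⁻ t in Ioi T, ν.restrict Y {x | t < f x} ≤ ENNReal.ofReal (C₁ ^ 2 * a) :=
    calc ∫⁻ t in Ioi T, ν.restrict Y {x | t < f x}
        ≤ ∫⁻ t in Ioi T, ENNReal.ofReal (Real.exp 1 * Real.exp (c * t)) :=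
          setLIntegral_mono' measurableSet_Ioi fun t ht => hbd2 t (hT0.trans_lt ht)
      _ = ENNReal.ofReal (∫ t in Ioi T, Real.exp 1 * Real.exp (c * t)) :=
          (ofReal_integral_eq_lintegral_ofReal hint
            (Filter.Eventually.of_forall fun t =>
              (mul_pos (Real.exp_pos _) (Real.exp_pos _)).le)).symm
      _ = ENNReal.ofReal (C₁ ^ 2 * a) := by
          rw [integral_const_mul, integral_exp_mul_Ioi hc0 T]
          congr 1
          have hC₁' : C₁ ≠ 0 := hC₁.ne'
          have he : Real.exp 1 ≠ 0 := (Real.exp_pos 1).ne'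
          have hcT : c * T = Real.log a - 1 := by
            rw [hc, hT]; field_simp; ring
          rw [hcT, Real.exp_sub, Real.exp_log hapos, hc]
          field_simp
  have hsplit : ∫⁻ t in Ioi 0, ν.restrict Y {x | t < f x} =
      (∫⁻ t in Ioc 0 T, ν.restrict Y {x | t < f x}) +
        ∫⁻ t in Ioi T, ν.restrict Y {x | t < f x} := by
    rw [← lintegral_union measurableSet_Ioi Ioc_disjoint_Ioi_same, Ioc_union_Ioi_eq_Ioi hT0]
  have htot : ∫⁻ x, ENNReal.ofReal (f x) ∂(ν.restrict Y) ≤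
      ENNReal.ofReal (a * T + C₁ ^ 2 * a) := by
    rw [hlc, hsplit, ENNReal.ofReal_add (mul_nonneg ha0 hT0) (mul_nonneg (sq_nonneg _) ha0)]
    exact add_le_add hp1 hp2
  -- back to the Bochner integral
  rw [integral_eq_lintegral_of_nonneg_ae (ae_of_all _ hf0) hfm.aestronglyMeasurable]
  refine (ENNReal.toReal_le_of_le_ofReal
    (add_nonneg (mul_nonneg ha0 hT0) (mul_nonneg (sq_nonneg _) ha0)) htot).trans ?_
  have hkey : 0 ≤ C₁ ^ 2 * a * (-Real.log a) :=
    mul_nonneg (mul_nonneg (sq_nonneg C₁) ha0) (neg_nonneg.mpr hlog)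
  rw [hT]
  nlinarith [hkey]

end Literature.Probability.Distributions
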